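import Literature.NumberTheory.EllipticCurves.HeegnerPointsKolyvaginPrimaryCebotarevProofs
import HarnessLib

/-!
# A Kolyvagin prime with a prescribed Frobenius on finitely many classes (Čebotarev step)

Sibling proof file of `HeegnerPointsKolyvaginPrimaryCebotarevProofs` (McCallum 1991, Cor. 3.2 at
level `p^M`), isolating its Steps C–G — the finite exceptional set, a Frobenius in
`c₀ · res(ρ𝒩)` by the Čebotarev density theorem, inertness, and the local criterion at the place
`λ ∋ ℓ` — as a statement about an ARBITRARY element `ρ ∈ Γ_{K(E[p^M])}` and finitely many
classes `c_i ∈ H¹(K, E[p^M])`: there is a Kolyvagin prime `ℓ > b` of level `p^M`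
(`ℓ ∤ N d_K p`, `(ℓ)` prime in `𝓞 K`, `Frob(ℓ) = Frob(∞)` on `K(E_{p^M})`) and `m ∈ 𝒩` (the
subgroup where all `[c_i, ·]` vanish) such that, for every class `x` in the span of the `c_i`,
**`x_λ = 0 ⟺ [x, (ρm)^τ (ρm)] = 0`** (McCallum's (3), PDF p. 280, for `φ_{Frob(λ)}` with
`Frob(λ) = (τρm)² = (ρm)^τ(ρm)`):

* `exists_kolyvaginPrime_gt_of_galoisElement`.

With Step B of Cor. 3.2 (`IsLiftOfAut.exists_h1Eval_conj_mul_order`: `ρ` prescribing orders) this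
is `exists_kolyvaginPrime_gt_pow`; with the kernel-form Step B of
`HeegnerPointsKolyvaginPrimaryCebotarevKernelProofs` (`ρ` realising a character with prescribed
kernel) it gives McCallum's Prop. 3.1 in kernel form. The proof is that file's Steps C–G
verbatim, the local criterion being applied to the span of the `c_i` (a subgroup of classes
unramified at `λ`). No named fact is introduced; inputs: the Čebotarev density theorem
(`Automorphic.chebotarev_artinRep`).

## References

* W. G. McCallum, *Kolyvagin's work on Shafarevich–Tate groups*, LMS Lecture Note Ser. 153
  (1991), 295–316, §3 Prop. 3.1 (proof), (3) (PDF p. 280). [McCallumLMS1991]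
* J. Tate, *Global class field theory*, in Cassels–Fröhlich (1967), §2.4. [TateGCFT1967]
-/

noncomputable section

open scoped Classical Pointwise
open WeierstrassCurve NumberField IsDedekindDomain Field
open Literature.NumberTheory.GaloisRepresentations

universe u

namespace Literature.NumberTheory.EllipticCurves

section Main

variable {W : WeierstrassCurve ℚ} {K : Type u} [Field K] [NumberField K]

/-- **McCallum 1991, Prop. 3.1, Čebotarev step: a Kolyvagin prime whose Frobenius over `K` is
`(ρm)^τ(ρm)` for some `m ∈ 𝒩`**, with McCallum's (3) — *"`c_λ = 0` if and only if
`φ_{Frob(λ)}(c) = 0`"* — for every class `x` in the span of the given classes `c_i`: for `K`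
imaginary quadratic with complex conjugation `c`, its lift `τ = e c₀ e⁻¹` to `K̄`, `p` prime,
`ρ ∈ Γ_{K(E[p^M])}` and any bound `b`, there are a prime `ℓ > b` with `ℓ ∤ N d_K`, `ℓ ≠ p`,
`(ℓ)` prime in `𝓞 K`, `Frob(ℓ) = Frob(∞)` in `Gal(K(E_{p^M})/ℚ)`, and `m ∈ 𝒩` with
`x_λ = 0 ⟺ [x, (ρm)^τ(ρm)] = 0` at the place `λ ∋ ℓ` for all `x ∈ ⟨c_i⟩`.
[cite: McCallumLMS1991, §3 Prop. 3.1 (proof), (3)] -/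
theorem exists_kolyvaginPrime_gt_of_galoisElement (hC : Automorphic.chebotarev_artinRep) {N : ℕ}
    [NeZero N] [W.IsElliptic] (hK : IsImaginaryQuadratic K) {p : ℕ} (hp : p.Prime) {M : ℕ}
    {c : K ≃ₐ[ℚ] K} {c₀ : absoluteGaloisGroup ℚ} (hc₀ : IsComplexConjugation (Rat.castHom ℝ) c₀)
    (ht : IsLiftOfAut c (absGaloisTransport (K := ℚ) (L := K) c₀).toRingEquiv)
    (hinv : ∀ x, (absGaloisTransport (K := ℚ) (L := K) c₀).toRingEquiv
      ((absGaloisTransport (K := ℚ) (L := K) c₀).toRingEquiv x) = x)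
    {ι : Type*} [Fintype ι] (cs : ι → galH1Torsion (W.baseChange K) ((p ^ M : ℕ) : ℤ))
    {ρ : absoluteGaloisGroup K} (hρT : ρ ∈ torsionFixing (W.baseChange K) ((p ^ M : ℕ) : ℤ))
    (b : ℕ) :
    ∃ ℓ : ℕ, b < ℓ ∧ ℓ.Prime ∧ ¬ ℓ ∣ N ∧ ¬ ((ℓ : ℤ) ∣ NumberField.discr K) ∧ ℓ ≠ p ∧
      (Ideal.span {(ℓ : 𝓞 K)}).IsPrime ∧ FrobEqFrobInfty W K (p ^ M) ℓ ∧
      ∃ m ∈ evalKer (W.baseChange K) ((p ^ M : ℕ) : ℤ) cs,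
        ∀ x ∈ AddSubgroup.closure (Set.range cs),
          ∀ v : HeightOneSpectrum (𝓞 K), (ℓ : 𝓞 K) ∈ v.asIdeal →
            (x ∈ (W.baseChange K).torsionLocalKer (v.adicCompletion K) ((p ^ M : ℕ) : ℤ) ↔
              h1Eval (W.baseChange K) ((p ^ M : ℕ) : ℤ) x (ht.conjGalCMH (ρ * m) * (ρ * m)) = 0) := by
  classical
  haveI : Fact p.Prime := ⟨hp⟩
  haveI : Algebra.IsQuadraticExtension ℚ K := ⟨hK.1⟩
  haveI : IsTotallyComplex K := hK.2
  have hn0 : ((p ^ M : ℕ) : ℤ) ≠ 0 := by exact_mod_cast pow_ne_zero M hp.ne_zero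
  -- ### Step C: the finite exceptional set of places of `ℚ`
  have hbad : ((W.baseChange K).badPlaces (𝓞 K)).Finite :=
    (W.baseChange K).finite_badPlaces_holds (𝓞 K)
  choose T hTfin hT using fun i ↦
    exists_finite_forall_mem_unramifiedKer (W.baseChange K) hn0 (cs i)
  set B : Finset ℕ := {p} ∪ N.primeFactors ∪ (NumberField.discr K).natAbs.primeFactors ∪
    Finset.range (b + 1) with hB
  set S₁ : Set (HeightOneSpectrum (𝓞 ℚ)) := {v | ∃ q ∈ B, q.Prime ∧ (q : 𝓞 ℚ) ∈ v.asIdeal}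
    with hS₁
  set S₂ : Set (HeightOneSpectrum (𝓞 ℚ)) := {v | ¬ Algebra.IsUnramifiedIn (𝓞 K) v.asIdeal}
    with hS₂
  set S₃ : Set (HeightOneSpectrum (𝓞 ℚ)) :=
    (fun w : HeightOneSpectrum (𝓞 K) ↦ w.under (𝓞 ℚ)) ''
      ((W.baseChange K).badPlaces (𝓞 K) ∪ ⋃ i, T i) with hS₃
  have hS₁fin : S₁.Finite := by
    have : S₁ ⊆ ⋃ q ∈ (B.filter Nat.Prime), {v | (q : 𝓞 ℚ) ∈ v.asIdeal} := by
      intro v ⟨q, hqB, hq, hqv⟩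
      simp only [Set.mem_iUnion, Finset.mem_filter]
      exact ⟨q, ⟨hqB, hq⟩, hqv⟩
    refine Set.Finite.subset (Set.Finite.biUnion (Finset.finite_toSet _) fun q hq ↦ ?_) this
    rw [Finset.coe_filter, Set.mem_setOf_eq] at hq
    have hsub : {v : HeightOneSpectrum (𝓞 ℚ) | (q : 𝓞 ℚ) ∈ v.asIdeal}.Subsingleton :=
      fun v hv v' hv' ↦ HeightOneSpectrum.eq_of_natCast_mem_rat hq.2 hv hv'
    exact hsub.finite
  have hS₂fin : S₂.Finite := finite_setOf_not_isUnramifiedIn ℚ K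
  have hS₃fin : S₃.Finite :=
    (hbad.union (Set.finite_iUnion fun i ↦ hTfin i)).image _
  set S := S₁ ∪ S₂ ∪ S₃ with hSdef
  have hSfin : S.Finite := (hS₁fin.union hS₂fin).union hS₃fin
  -- ### Step D: Čebotarev in `Γ_ℚ`: a Frobenius in the open set `c₀ · res(ρ 𝒩)`
  have h𝒩open : IsOpen ((evalKer (W.baseChange K) ((p ^ M : ℕ) : ℤ) cs :
      Subgroup (absoluteGaloisGroup K)) : Set (absoluteGaloisGroup K)) :=
    isOpen_evalKer (W.baseChange K) _ cs (isOpen_torsionFixing (W.baseChange K) hn0)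
  obtain ⟨O, hO⟩ : ∃ O : Set (absoluteGaloisGroup ℚ), O = (fun γ ↦ c₀ * γ) ''
      (absGaloisRestrict ℚ K '' ((fun m ↦ ρ * m) ''
        ((evalKer (W.baseChange K) ((p ^ M : ℕ) : ℤ) cs : Subgroup (absoluteGaloisGroup K)) :
          Set (absoluteGaloisGroup K)))) := ⟨_, rfl⟩
  have hOopen : IsOpen O := by
    rw [hO]
    refine (Homeomorph.mulLeft c₀).isOpenMap _ (isOpenMap_absGaloisRestrict K _ ?_)
    exact (Homeomorph.mulLeft ρ).isOpenMap _ h𝒩open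
  have hOne : O.Nonempty :=
    ⟨c₀ * absGaloisRestrict ℚ K (ρ * 1), hO ▸ ⟨_, ⟨_, ⟨1, Subgroup.one_mem _, rfl⟩, rfl⟩, rfl⟩⟩
  obtain ⟨γ, hγO, v, hvS, 𝔓₀, h𝔓₀, hγ⟩ :=
    (absoluteGaloisGroup.frobenius_dense hC ℚ S hSfin).inter_open_nonempty O hOopen hOne
  rw [hO] at hγO
  obtain ⟨_, ⟨_, ⟨m, hm, rfl⟩, rfl⟩, rfl⟩ := hγO
  let g := ρ * m
  have hgT : g ∈ torsionFixing (W.baseChange K) ((p ^ M : ℕ) : ℤ) := mul_mem hρT hm.1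
  -- ### Step E: the rational prime `ℓ` under `v`
  obtain ⟨ℓ, hℓ, hℓv⟩ := exists_prime_natCast_mem v
  have hℓB : ℓ ∉ B := fun h ↦ hvS (Or.inl (Or.inl ⟨ℓ, h, hℓ, hℓv⟩))
  simp only [hB, Finset.mem_union, Finset.mem_singleton, Nat.mem_primeFactors,
    Finset.mem_range, not_or] at hℓB
  obtain ⟨⟨⟨hℓp, hℓN⟩, hℓD⟩, hℓb⟩ := hℓB
  have hℓN' : ¬ ℓ ∣ N := fun h ↦ hℓN ⟨hℓ, h, NeZero.ne N⟩
  have hℓD' : ¬ ((ℓ : ℤ) ∣ NumberField.discr K) := fun h ↦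
    hℓD ⟨hℓ, Int.natAbs_dvd_natAbs.mpr h |>.trans (by simp), by
      simp [NumberField.discr_ne_zero]⟩
  have hbℓ : b < ℓ := by omega
  have hunr : Algebra.IsUnramifiedIn (𝓞 K) v.asIdeal := by
    by_contra h; exact hvS (Or.inl (Or.inr h))
  have hvS₃ : v ∉ S₃ := fun h ↦ hvS (Or.inr h)
  -- ### Step F: `ℓ` is inert, with a Frobenius `τ' = g^τ g` over `K`
  have hHi := index_range_absGaloisRestrict_eq_finrank ℚ K
  haveI hHn : ((absGaloisRestrict ℚ K).range).Normal :=
    Subgroup.normal_of_index_eq_two (hHi.trans hK.1)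
  have hI := inertia_le_range_absGaloisRestrict_of_isUnramifiedIn (K := K) hunr h𝔓₀
  have hΦH : c₀ * absGaloisRestrict ℚ K g ∉ (absGaloisRestrict ℚ K).range := by
    intro h
    apply hc₀.not_mem_range_absGaloisRestrict (L := K) IsTotallyComplex.isComplex
    change c₀ ∈ ((absGaloisRestrict ℚ K).range : Set (absoluteGaloisGroup ℚ))
    have h' : c₀ = c₀ * absGaloisRestrict ℚ K g * (absGaloisRestrict ℚ K g)⁻¹ := by group
    rw [SetLike.mem_coe, h']
    exact Subgroup.mul_mem _ h (Subgroup.inv_mem _ ⟨g, rfl⟩)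
  obtain ⟨w, 𝔔, τ', hwv, hwuniq, -, h𝔔w, -, hτ', hresτ'⟩ :=
    exists_place_inert_of_not_mem_range (F := ℚ) (M := K) (hK.1 ▸ Nat.prime_two) hHn
      (hHi.trans rfl) hunr h𝔓₀ hI hγ hΦH
  rw [hK.1, sq_eq_absGaloisRestrict_conjGal_mul hc₀ ht g] at hresτ'
  have hτ'eq : τ' = ht.conjGalCMH g * g := absGaloisRestrict_injective ℚ K hresτ'
  -- `ℓ ∈ w`, and `w` is the only place of `K` containing `ℓ`
  have hℓw : (ℓ : 𝓞 K) ∈ w.asIdeal := by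
    have h1 : (ℓ : 𝓞 ℚ) ∈ (w.under (𝓞 ℚ)).asIdeal := by rw [hwv]; exact hℓv
    rw [HeightOneSpectrum.under_asIdeal, Ideal.under_def, Ideal.mem_comap, map_natCast] at h1
    exact h1
  have hwuniq' : ∀ w' : HeightOneSpectrum (𝓞 K), (ℓ : 𝓞 K) ∈ w'.asIdeal → w' = w := by
    intro w' hw'
    apply hwuniq
    apply HeightOneSpectrum.eq_of_natCast_mem_rat hℓ _ hℓv
    rw [HeightOneSpectrum.under_asIdeal, Ideal.under_def, Ideal.mem_comap, map_natCast]
    exact hw'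
  -- `(ℓ) = w` is prime
  have hspan : Ideal.span {(ℓ : 𝓞 K)} = w.asIdeal := by
    apply span_natCast_eq_of_unique hℓ w hwuniq'
    haveI : w.asIdeal.LiesOver v.asIdeal := ⟨by rw [← hwv]; rfl⟩
    have hmap : v.asIdeal.map (algebraMap (𝓞 ℚ) (𝓞 K)) = Ideal.span {(ℓ : 𝓞 K)} := by
      rw [← span_natCast_rat_eq hℓ hℓv, Ideal.map_span, Set.image_singleton, map_natCast]
    have hne : v.asIdeal.map (algebraMap (𝓞 ℚ) (𝓞 K)) ≠ ⊥ := by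
      rw [hmap, Ne, Ideal.span_singleton_eq_bot]; exact_mod_cast hℓ.ne_zero
    rw [← hmap, ← Ideal.IsDedekindDomain.ramificationIdx_eq_normalizedFactors_count v.asIdeal
      w.asIdeal hne]
    exact Ideal.ramificationIdx_eq_one_iff.mpr (hunr w.asIdeal w.isPrime inferInstance)
  -- ### Step G: the local criterion at `w`, for every class in the span of the `c_i`
  have hwT : ∀ i, w ∉ T i := fun i h ↦ hvS₃ ⟨w, Or.inr (Set.mem_iUnion.mpr ⟨i, h⟩), hwv⟩
  have hloc : ∀ x ∈ AddSubgroup.closure (Set.range cs),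
      (x ∈ (W.baseChange K).torsionLocalKer (w.adicCompletion K) ((p ^ M : ℕ) : ℤ) ↔
        h1Eval (W.baseChange K) ((p ^ M : ℕ) : ℤ) x (ht.conjGalCMH (ρ * m) * (ρ * m)) = 0) := by
    intro x hx
    haveI : CharZero (w.adicCompletion K) :=
      charZero_of_injective_algebraMap (algebraMap K (w.adicCompletion K)).injective
    obtain ⟨𝔐, h𝔐⟩ := w.localPrimesAbove_nonempty
    set 𝔓w := w.primeBelow (closureEmb (K := K) (w.adicCompletion K)) 𝔐 with h𝔓w_def
    have h𝔓w : 𝔓w ∈ w.primesAbove := w.primeBelow_mem_primesAbove h𝔐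
    obtain ⟨δ, hδ, hF⟩ :=
      HeightOneSpectrum.exists_isArithFrobAt_conj_of_mem_primesAbove_holds h𝔔w h𝔓w hτ'
    have hτ'T : τ' ∈ torsionFixing (W.baseChange K) ((p ^ M : ℕ) : ℤ) := by
      rw [hτ'eq]; exact mul_mem (ht.conjGalCMH_mem_torsionFixing W hinv _ hgT) hgT
    have hFT : δ * τ' * δ⁻¹ ∈ torsionFixing (W.baseChange K) ((p ^ M : ℕ) : ℤ) :=
      (torsionFixing_normal (W.baseChange K) _).conj_mem _ hτ'T δ
    have hwbad : w ∉ (W.baseChange K).badPlaces (𝓞 K) := fun h ↦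
      hvS₃ ⟨w, Or.inl h, hwv⟩
    have hpw : ((p : ℤ) : 𝓞 K) ∉ w.asIdeal := by
      rw [Int.cast_natCast]
      exact not_natCast_mem_of_prime_ne hℓ hp hℓp w hℓw
    have hpMw : ((((p ^ M : ℕ) : ℤ)) : 𝓞 K) ∉ w.asIdeal := fun h ↦ by
      apply hpw
      rw [Int.cast_natCast, Nat.cast_pow] at h
      rw [Int.cast_natCast]
      exact w.isPrime.mem_of_pow_mem M h
    have hcrit := mem_torsionLocalKer_iff_h1Eval_eq_zero (W.baseChange K) ((p ^ M : ℕ) : ℤ) h𝔐 hF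
      hFT (inertia_le_torsionFixing (W.baseChange K) hwbad hpMw _ h𝔐)
      (isOpen_torsionFixing (W.baseChange K) hn0)
      (torsionPointsMap_bijective (W.baseChange K) (w.adicCompletion K)
        (pow_ne_zero M hp.ne_zero)).2 (x := x)
      ((AddSubgroup.closure_le _).mpr (Set.range_subset_iff.mpr fun i ↦ hT i w (hwT i) 𝔓w h𝔓w)
        hx)
    rw [hcrit, h1Eval_conj (W.baseChange K) _ _ δ hτ'T, smul_eq_zero_iff_eq, hτ'eq]
  -- ### Step H: assemble
  refine ⟨ℓ, hbℓ, hℓ, hℓN', hℓD', hℓp, hspan ▸ w.isPrime, ?_, m, hm, fun x hx v' hv' ↦ ?_⟩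
  · -- `Frob(ℓ) = Frob(∞)`: `γ = c₀ · res g` acts on `E(ℚ̄)[p^M]` and on `K` as `c₀`
    refine ⟨v, 𝔓₀, c₀ * absGaloisRestrict ℚ K g, c₀, hℓv, h𝔓₀, hγ, hc₀, fun P ↦ ?_, fun e x ↦ ?_⟩
    · rw [mul_smul, absGaloisRestrict_smul_eq_of_mem_torsionFixing W hgT]
    · rw [mul_smul, absGaloisRestrict_smul_apply_eq g e x]
  · rw [hwuniq' v' hv']
    exact hloc x hx

end Main

end Literature.NumberTheory.EllipticCurves

end
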